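import Literature.ModelTheory.FiniteModelTheory.ESOPrefixClasses
import Mathlib.ModelTheory.Complexity
import HarnessLib

/-!
# Non-3-colourability is not definable in `∃SO(∃*∀*)`

For the prefix-class machinery of `ESOPrefixClasses.lean` (`IsPrefixDefinable ar w C`: some
`∃SO` sentence `∃R̄ ∃c̄ Q̄ θ`, `θ` quantifier-free, first-order prefix word `w`, defines `C`):

* `nonThreeColClass_not_isPrefixDefinable_forall` — **PROVED**: for every `q`, no sentence of
  prefix class `∃R̄ ∃^p ∀^q` (witness relations of ANY arities, any number `p` of leading
  first-order existentials) defines the class `𝒩 = nonThreeColClass` of finite binary tables whose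
  loop-free symmetrised graph is not 3-colourable. Equivalently: 𝒩 ∉ ESO(∃*∀*), the
  Bernays–Schönfinkel–Ramsey / Kolaitis–Vardi prefix class of `∃SO`.

Mechanism (Kolaitis–Vardi 1987; Libkin 2004 §12.4, proof of Lemma 12.14): in an `∃SO(∃*∀*)`
sentence the second-order witnesses and the first-order existential witnesses `a₁ … a_p` can be
RESTRICTED to any induced substructure containing `a₁ … a_p` — universal first-order formulas are
preserved downwards along embeddings (Mathlib `BoundedFormula.IsUniversal.realize_embedding`), and
witness tables pull back along the inclusion (`induceTables`). So a definable class containing a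
structure contains an induced substructure of it on at most `p` named points plus anything. The
odd wheel `W_{2p+3}` (hub joined to an odd cycle of length `2p+3`) is not 3-colourable, while every
induced subgraph missing a rim vertex is (`OddWheel.*`, elementary) — and `p` constants miss one of
the `2p+3` rim vertices. Hence no such sentence defines 𝒩.

This is the `∀*` rung of the prefix axis of Fagin's generalized-spectrum ladder for 𝒩 (Fagin 1993
§5: 𝒩 is a generalized spectrum iff NP = coNP); it is used as the witness-of-weakness rung of the
crux `𝒩 ∉ ESO(∃*∀∃∀)` of route `Summits/PneNP/PneNP/Theses/NonThreeColCutRectangles`.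

## References

* Ph. G. Kolaitis, M. Y. Vardi, *The decision problem for the probabilities of higher-order
  properties*, STOC 1987 (the `∃SO(∃*∀*)` class; restriction of witnesses to finite substructures).
* L. Libkin, *Elements of Finite Model Theory*, Springer 2004, §12.4, Lemmas 12.13–12.14,
  Thm. 12.12 (the same restriction argument), Exercise 3.14 (Łoś–Tarski direction that survives
  in the finite: universal sentences are preserved under substructures).
* R. Fagin, *Finite-model theory — a personal perspective*, TCS 116 (1993), §5 (the class 𝒩).
-/

namespace Literature.ModelTheory.FiniteModelTheory

open Literature.Computability.Cryptography FirstOrder FirstOrder.Language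

/-! ### Pulling tables back along a map of universes -/

/-- Pull input/witness tables on `Fin N` back along `ι : Fin m → Fin N`: the tables of the induced
substructure when `ι` is injective. [folklore] -/
def induceTables {ar : List ℕ} {m N : ℕ} (ι : Fin m → Fin N) (R : RelTables ar N) : RelTables ar m :=
  fun i v => R i (ι ∘ v)

/-- The symmetrised adjacency of pulled-back binary tables is the pulled-back adjacency. [folklore] -/
theorem adjTable_induceTables {m N : ℕ} (ι : Fin m → Fin N) (R : RelTables [2] N) (a b : Fin m) :
    adjTable (induceTables ι R) a b = adjTable R (ι a) (ι b) := by
  unfold adjTable induceTables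
  congr 1
  funext i
  rcases i with ⟨_ | _ | k, hk⟩
  · rfl
  · rfl
  · exfalso
    simp only [List.get_eq_getElem, List.getElem_cons_zero] at hk
    omega

/-! ### The odd wheel -/

namespace OddWheel

/-- Adjacency of the wheel on `Fin (M+1)`: rim = the vertices of value `< M` in cyclic order,
hub = the vertex of value `M`, adjacent to every rim vertex. [folklore] -/
def wheelFn (M : ℕ) (u v : Fin (M + 1)) : Bool :=
  decide ((u.val < M ∧ v.val < M ∧ (u.val + 1 = v.val ∨ v.val + 1 = u.val ∨
      (u.val = 0 ∧ v.val + 1 = M) ∨ (v.val = 0 ∧ u.val + 1 = M))) ∨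
    (u.val = M ∧ v.val < M) ∨ (u.val < M ∧ v.val = M))

/-- Unfolding of `wheelFn`. [folklore] -/
theorem wheelFn_iff (M : ℕ) (u v : Fin (M + 1)) :
    wheelFn M u v = true ↔ ((u.val < M ∧ v.val < M ∧ (u.val + 1 = v.val ∨ v.val + 1 = u.val ∨
      (u.val = 0 ∧ v.val + 1 = M) ∨ (v.val = 0 ∧ u.val + 1 = M))) ∨
    (u.val = M ∧ v.val < M) ∨ (u.val < M ∧ v.val = M)) := by
  simp only [wheelFn, decide_eq_true_eq]

/-- The wheel as the graph of its input table. [folklore] -/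
def wheel (M : ℕ) : SimpleGraph (Fin (M + 1)) := graphOfTables (tablesOfAdj (wheelFn M))

/-- Adjacency in `wheel M`. [folklore] -/
theorem wheel_adj (M : ℕ) (u v : Fin (M + 1)) :
    (wheel M).Adj u v ↔ u ≠ v ∧ (wheelFn M u v = true ∨ wheelFn M v u = true) := by
  unfold wheel
  rw [graphOfTables_adj, adjTable_tablesOfAdj, adjTable_tablesOfAdj]

/-- A small finite fact about three colours. [folklore] -/
theorem fin3_step : ∀ a s x y : Fin 3, s ≠ a → x ≠ a → y ≠ a → x ≠ y → (x = s ↔ ¬ y = s) := by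
  decide

/-- **The odd wheel `W_{2j+3}` is not 3-colourable** (with the rim size as a variable). [folklore] -/
theorem wheel_not_colorable_aux (j M : ℕ) (hM : M = 2 * j + 3) : ¬ (wheel M).Colorable 3 := by
  rintro ⟨c⟩
  let hub : Fin (M + 1) := ⟨M, by omega⟩
  have rimLt : ∀ i, i < M → i < M + 1 := fun i hi => by omega
  let rim : ∀ i, i < M → Fin (M + 1) := fun i hi => ⟨i, rimLt i hi⟩
  have hadj_hub : ∀ i (hi : i < M), (wheel M).Adj hub (rim i hi) := by
    intro i hi
    rw [wheel_adj]
    refine ⟨fun h => ?_, Or.inl ?_⟩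
    · have := congrArg Fin.val h
      simp only [hub, rim] at this
      omega
    · rw [wheelFn_iff]; right; left; exact ⟨rfl, hi⟩
  have hadj_rim : ∀ i (hi : i + 1 < M), (wheel M).Adj (rim i (by omega)) (rim (i + 1) hi) := by
    intro i hi
    rw [wheel_adj]
    refine ⟨fun h => ?_, Or.inl ?_⟩
    · have := congrArg Fin.val h
      simp only [rim] at this
      omega
    · rw [wheelFn_iff]; left; exact ⟨(by omega : i < M), hi, Or.inl rfl⟩
  have hadj_wrap : (wheel M).Adj (rim 0 (by omega)) (rim (M - 1) (by omega)) := by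
    rw [wheel_adj]
    refine ⟨fun h => ?_, Or.inl ?_⟩
    · have := congrArg Fin.val h
      simp only [rim] at this
      omega
    · rw [wheelFn_iff]; left
      exact ⟨(by omega : 0 < M), (by omega : M - 1 < M), Or.inr (Or.inr (Or.inl ⟨rfl, (by omega : M - 1 + 1 = M)⟩))⟩
  obtain ⟨s, hs⟩ := exists_ne (c hub)
  have hne_hub : ∀ i (hi : i < M), c (rim i hi) ≠ c hub :=
    fun i hi => (c.valid (hadj_hub i hi)).symm
  -- parity propagation along the rim
  have prop : ∀ i (hi : i < M),
      (c (rim i hi) = s ↔ (Even i ↔ c (rim 0 (by omega)) = s)) := by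
    intro i
    induction i with
    | zero => intro hi; simp
    | succ i ih =>
      intro hi
      have h1 := ih (by omega)
      have h2 : c (rim (i + 1) hi) = s ↔ ¬ c (rim i (by omega)) = s :=
        fin3_step (c hub) s _ _ hs (hne_hub _ hi) (hne_hub _ (by omega))
          (c.valid (hadj_rim i hi)).symm
      rw [h2, h1, Nat.even_add_one]
      tauto
  have hlast := prop (M - 1) (by omega)
  have hEven : Even (M - 1) := ⟨j + 1, by omega⟩
  have hwrap : c (rim 0 (by omega)) = s ↔ ¬ c (rim (M - 1) (by omega)) = s :=
    fin3_step (c hub) s _ _ hs (hne_hub _ (by omega)) (hne_hub _ (by omega))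
      (c.valid hadj_wrap)
  rw [hlast] at hwrap
  tauto

/-- **The odd wheel `W_{2j+3}` is not 3-colourable.** [folklore] -/
theorem wheel_not_colorable (j : ℕ) : ¬ (wheel (2 * j + 3)).Colorable 3 :=
  wheel_not_colorable_aux j _ rfl

/-- Colours for the wheel minus the rim vertex `ρ`: hub ↦ 2, rim vertex `u` ↦ parity of its
cyclic distance from `ρ`. [folklore] -/
def wheelColour (M ρ u : ℕ) : ℕ :=
  if u = M then 2 else (if ρ < u then u - ρ else u + M - ρ) % 2

/-- The colours are `< 3`. [folklore] -/
theorem wheelColour_lt (M ρ u : ℕ) : wheelColour M ρ u < 3 := by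
  unfold wheelColour; split_ifs <;> omega

/-- **Every induced subgraph of the wheel missing a rim vertex is 3-colourable** (stated for
the pulled-back tables along any map `ι` whose range misses the rim vertex of value `ρ`). [folklore] -/
theorem colorable_pull_wheel {M m : ℕ} (ι : Fin m → Fin (M + 1)) (ρ : ℕ) (hρ : ρ < M)
    (hmiss : ∀ a, (ι a).val ≠ ρ) :
    (graphOfTables (induceTables ι (tablesOfAdj (wheelFn M)))).Colorable 3 := by
  refine ⟨SimpleGraph.Coloring.mk (fun a => ⟨wheelColour M ρ (ι a).val, wheelColour_lt _ _ _⟩) ?_⟩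
  intro a b hab heq
  rw [graphOfTables_adj, adjTable_induceTables, adjTable_induceTables, adjTable_tablesOfAdj,
    adjTable_tablesOfAdj, wheelFn_iff, wheelFn_iff] at hab
  obtain ⟨-, h⟩ := hab
  have ha := hmiss a
  have hb := hmiss b
  have hva := (ι a).isLt
  have hvb := (ι b).isLt
  have heqv : wheelColour M ρ (ι a).val = wheelColour M ρ (ι b).val := by
    simpa [Fin.ext_iff] using heq
  unfold wheelColour at heqv
  split_ifs at heqv <;> omega

end OddWheel

/-! ### The rung -/

open OddWheel in
/-- **Non-3-colourability is not `∃SO(∃*∀*)`-definable**: for every `q`, no `∃SO` sentence with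
witness relations of any arities, any number of leading first-order existential quantifiers and `q`
universal first-order quantifiers over a quantifier-free matrix defines `nonThreeColClass`
(restriction of witnesses to the induced substructure on the named points, applied to the odd
wheel `W_{2p+3}`). [Kolaitis–Vardi 1987; Libkin 2004, §12.4, Lemma 12.14 (the restriction
argument)] [cite: Libkin2004, §12.4, Lemma 12.14] -/
theorem nonThreeColClass_not_isPrefixDefinable_forall (q : ℕ) :
    ¬ IsPrefixDefinable [2] (List.replicate q FOQuant.all) nonThreeColClass := by
  rintro ⟨wit, p, θ, hθ, hclass⟩
  have hmem := Set.ext_iff.1 hclass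
  -- the host: the odd wheel with `M = 2p+3` rim vertices
  set M := 2 * p + 3 with hM
  set R : RelTables [2] (M + 1) := tablesOfAdj (wheelFn M) with hR
  have hW : (⟨M + 1, R⟩ : SNPInstance [2]) ∈ nonThreeColClass := by
    rw [mem_nonThreeColClass_iff]
    exact wheel_not_colorable p
  rw [← hmem, ESOSentence.mem_modelClass_ofPrefix_iff] at hW
  obtain ⟨W, cs, hreal⟩ := hW
  -- a rim vertex missed by the constants
  classical
  obtain ⟨ρ, hρT, hρcs⟩ : ∃ ρ ∈ (Finset.univ.filter fun v : Fin (M + 1) => v.val < M),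
      ρ ∉ Finset.univ.image cs := by
    apply Finset.exists_mem_notMem_of_card_lt_card
    calc (Finset.univ.image cs).card ≤ (Finset.univ : Finset (Fin p)).card := Finset.card_image_le
      _ = p := Finset.card_fin p
      _ < M := by omega
      _ = (Finset.univ.image (Fin.castSucc : Fin M → Fin (M + 1))).card := by
          rw [Finset.card_image_of_injective _ (Fin.castSucc_injective M), Finset.card_fin]
      _ ≤ (Finset.univ.filter fun v : Fin (M + 1) => v.val < M).card := by
          apply Finset.card_le_card
          intro v hv
          simp only [Finset.mem_image, Finset.mem_univ, true_and] at hv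
          obtain ⟨a, rfl⟩ := hv
          simp
  have hρM : ρ.val < M := by simpa using hρT
  have hmiss : ∀ i, cs i ≠ ρ := by
    intro i h
    apply hρcs
    rw [Finset.mem_image]
    exact ⟨i, Finset.mem_univ _, h⟩
  -- the induced substructure on the range of the constants
  set T : Finset (Fin (M + 1)) := Finset.univ.image cs with hT
  set m := T.card with hm
  let e := T.orderIsoOfFin rfl
  let ι : Fin m → Fin (M + 1) := fun a => (e a).val
  have hιinj : Function.Injective ι := fun a b h => e.injective (Subtype.ext h)
  have hιmem : ∀ a, ι a ∈ T := fun a => (e a).property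
  have hcsT : ∀ i, cs i ∈ T := fun i => Finset.mem_image.2 ⟨i, Finset.mem_univ _, rfl⟩
  let cs' : Fin p → Fin m := fun i => e.symm ⟨cs i, hcsT i⟩
  have hcs' : ∀ i, ι (cs' i) = cs i := by
    intro i
    simp only [ι, cs', OrderIso.apply_symm_apply]
  have hιmiss : ∀ a, (ι a).val ≠ ρ.val := by
    intro a h
    have hmemT := hιmem a
    rw [Fin.ext_iff.symm] at h
    rw [h, hT, Finset.mem_image] at hmemT
    obtain ⟨i, -, hi⟩ := hmemT
    exact hmiss i hi
  -- the joint structures and the embedding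
  letI instN : (JointLang [2] wit).Structure (Fin (M + 1)) := jointStructure R W
  letI instm : (JointLang [2] wit).Structure (Fin m) :=
    jointStructure (induceTables ι R) (induceTables ι W)
  let emb : (JointLang [2] wit).Embedding (Fin m) (Fin (M + 1)) :=
    { toEmbedding := ⟨ι, hιinj⟩
      map_fun' := fun f _ => isEmptyElim f
      map_rel' := fun r x => by
        cases r with
        | inl r => exact Iff.rfl
        | inr r => exact Iff.rfl }
  have hU : (FOQuant.closePrefix (List.replicate q FOQuant.all) θ).IsUniversal :=
    FOQuant.isUniversal_closePrefix_replicate_all q θ (BoundedFormula.IsUniversal.of_isQF hθ)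
  have key2 : (⇑emb ∘ cs') = cs := funext hcs'
  have htransfer : ∀ v₀ : Empty → Fin (M + 1),
      (FOQuant.closePrefix (List.replicate q FOQuant.all) θ).Realize v₀ cs →
        (FOQuant.closePrefix (List.replicate q FOQuant.all) θ).Realize
          (default : Empty → Fin m) cs' := by
    intro v₀ h
    apply hU.realize_embedding emb
    rw [key2]
    convert h
  have hsmall := htransfer _ hreal
  -- so the induced subgraph on `T` would be non-3-colourable …
  have hmemSmall : (⟨m, induceTables ι R⟩ : SNPInstance [2]) ∈ nonThreeColClass := by
    rw [← hmem, ESOSentence.mem_modelClass_ofPrefix_iff]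
    exact ⟨induceTables ι W, cs', hsmall⟩
  rw [mem_nonThreeColClass_iff] at hmemSmall
  -- … but it misses the rim vertex `ρ`, hence is 3-colourable
  exact hmemSmall (colorable_pull_wheel ι ρ.val hρM hιmiss)

end Literature.ModelTheory.FiniteModelTheory
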